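import Summits.Ventures.LatticeQCDFlow.Scoring.SU2Cooling
import HarnessLib

/-!
# The `SU(2)` cooling map: an exact cooling step at every link, the ONLY one when the staple sum is non-zero, and a strict Lyapunov function

HONEST FRAMING: exact (Metropolis-corrected) sampling algorithms for lattice gauge theory;
figures of merit are autocorrelation/cost numbers at stated couplings and volumes; no
continuum-physics claim.

Venture `LatticeQCDFlow` (cell pub-lqcd), sub-topic `Scoring`; FANOUT row 16 (`su2-base`: two charge definitions,
clover-after-Wilson-flow and α-rounded-after-COOLING, whose integer roundings the row's acceptance test compares; finding
D1 = dependence of cooling on the visiting order).  NEW WORK of the cell (placement rule), part 3 of the cooling packet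
after `Scoring/WilsonStapleSum` (staple sum `R_e`, `S_e = 2(d−1)N − Re tr (ρ(U_e) R_e)`) and `Scoring/SU2Cooling`
(cooling steps never increase `S_W`; `Re tr (g R) ≤ 2√det R` on `SU(2)`, unique maximiser `coolMat R = Rᴴ/√det R`).
Nothing is cited as a fact; no number.  Printed counterparts, NAMED ONLY: Teper, Phys. Lett. B 162 (1985) 357;
Hoek–Teper–Waterhouse, Nucl. Phys. B 288 (1987) 589 (`SU(2)` cooling through the normalised staple sum).  Engine
counterpart: `latflow.core` release `core-0.1.1`, `csrc/latcore_template.c` `update_link` mode 2 ('cooling'):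
`W = u·R = k v` with `v ∈ SU(2)`, then `u ← v† u`; and `v† u = R†/k` because `u` is unitary (links with `k < 10⁻¹²`
are skipped) — one link at a time this is `su2Cool` below.

## What is proved (`G = SU(2) = Matrix.specialUnitaryGroup (Fin 2) ℂ`, fundamental representation, `L ≥ 2` where stated)

* §1 `isQuat_stapleSum`; `su2_linkAction_eq` (`S_e = 4(d−1) − Re tr (U_e R_e)`); **`su2_linkAction_fibre_ge`**
  (`S_e ≥ 4(d−1) − 2√det R_e` on the whole fibre of the link).
* §2 **`su2Cool U x μ`** — the link `(x, μ)` is replaced by `coolMat R_e` (left alone if `R_e = 0`):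
  `linkAction_su2Cool` (it attains the fibre minimum), **`isCoolingStep_su2Cool`** (it IS a cooling step of
  `Scoring/SU2Cooling`), `wilsonAction_su2Cool_le`, `wilsonAction_sub_wilsonAction_su2Cool`
  (`S_W(U) − S_W(cool_e U) = 2√det R_e − Re tr (U_e R_e) ≥ 0`), **`wilsonAction_su2Cool_lt`** (STRICT decrease whenever
  the link moves: `S_W` is a strict Lyapunov function of cooling), and **`IsCoolingStep.eq_su2Cool`**: for `R_e ≠ 0`
  EVERY exact cooling step at `e` equals `su2Cool U x μ` — two exact `SU(2)` cooling codes run in the same link order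
  agree link by link; only the visiting order can make them differ (finding D1).

NOT CLAIMED: fixed points and the relation to the Wilson flow (sequel `Scoring/SU2CoolingFixedPoints`); convergence of
iterated cooling or any rate; `SU(N ≥ 3)` (no closed-form minimiser; Cabibbo–Marinari subgroup cooling); any number.
-/

noncomputable section

open Matrix
open Literature.MathematicalPhysics.QuantumFieldTheory
open Literature.MathematicalPhysics.QuantumLattice (fundamentalRep fundamentalRep_apply continuous_fundamentalRep)
open Summit.Ventures.LatticeQCDFlow.TrivializingMaps (linkAction)
open Summit.Ventures.LatticeQCDFlow.Exactness (IsQuat)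
open Summit.Ventures.LatticeQCDFlow.Exactness.IsQuat (normSq)

namespace Summit.Ventures.LatticeQCDFlow.Scoring

variable {d L : ℕ}

/-! ## §1 The staple sum of an `SU(2)` field is a quaternion; the link action in staple form -/

/-- The staple sum of an `SU(2)` configuration (fundamental representation) is a quaternion. -/
theorem isQuat_stapleSum (U : GaugeConfig d L (specialUnitaryGroup (Fin 2) ℂ)) (x : Site d L) (μ : Fin d) :
    IsQuat (stapleSum (fundamentalRep (Fin 2)) U x μ) := by
  unfold stapleSum
  refine IsQuat.sum _ fun ν _ => IsQuat.add ?_ ?_ <;> rw [fundamentalRep_apply] <;>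
    exact IsQuat.of_mem_specialUnitaryGroup (SetLike.coe_mem _)

variable [NeZero L]

/-- **`S_e(U) = 4(d−1) − Re tr (U_e R_e(U))`** for an `SU(2)` field (`L ≥ 2`). -/
theorem su2_linkAction_eq (hL : 2 ≤ L) (U : GaugeConfig d L (specialUnitaryGroup (Fin 2) ℂ)) (x : Site d L)
    (μ : Fin d) :
    linkAction (fundamentalRep (Fin 2)) (x, μ) U =
      4 * ((d - 1 : ℕ) : ℝ) -
        ((U (x, μ) : Matrix (Fin 2) (Fin 2) ℂ) * stapleSum (fundamentalRep (Fin 2)) U x μ).trace.re := by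
  rw [linkAction_eq_staple (fundamentalRep (Fin 2)) hL (continuous_fundamentalRep (Fin 2)) U x μ,
    fundamentalRep_apply]
  push_cast
  ring

/-- **The link action is bounded below on every fibre**: `S_e(h ·_e U) ≥ 4(d−1) − 2 √det R_e(U)` for all
`h ∈ SU(2)` (`L ≥ 2`). -/
theorem su2_linkAction_fibre_ge (hL : 2 ≤ L) (U : GaugeConfig d L (specialUnitaryGroup (Fin 2) ℂ)) (x : Site d L)
    (μ : Fin d) (h : specialUnitaryGroup (Fin 2) ℂ) :
    4 * ((d - 1 : ℕ) : ℝ) - 2 * √(normSq (stapleSum (fundamentalRep (Fin 2)) U x μ)) ≤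
      linkAction (fundamentalRep (Fin 2)) (x, μ) (Pi.mulSingle (x, μ) h * U) := by
  rw [su2_linkAction_eq hL, stapleSum_mulSingle_self (fundamentalRep (Fin 2)) hL, mulSingle_mul_apply_self]
  have hle := re_trace_mul_le (SetLike.coe_mem (h * U (x, μ))) (isQuat_stapleSum U x μ)
  linarith

/-! ## §2 The `SU(2)` cooling map -/

omit [NeZero L] in
/-- The cooled link as an element of `SU(2)` (for a non-zero staple sum). -/
theorem coolMat_stapleSum_mem (U : GaugeConfig d L (specialUnitaryGroup (Fin 2) ℂ)) (x : Site d L) (μ : Fin d)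
    (h0 : stapleSum (fundamentalRep (Fin 2)) U x μ ≠ 0) :
    coolMat (stapleSum (fundamentalRep (Fin 2)) U x μ) ∈ specialUnitaryGroup (Fin 2) ℂ :=
  coolMat_mem (isQuat_stapleSum U x μ) h0

omit [NeZero L] in
/-- **The `SU(2)` cooling map at the link `(x, μ)`**: the link is replaced by `coolMat R = Rᴴ/√det R`, `R` its
staple sum — the exact minimiser of the link action; a link whose staple sum vanishes (every value ties) is left
alone.  One link at a time this is the cooling update of `latflow.core` (`update_link`, mode 2) and of the reference
checkerboard code. -/
def su2Cool (U : GaugeConfig d L (specialUnitaryGroup (Fin 2) ℂ)) (x : Site d L) (μ : Fin d) :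
    GaugeConfig d L (specialUnitaryGroup (Fin 2) ℂ) :=
  if h0 : stapleSum (fundamentalRep (Fin 2)) U x μ = 0 then U
  else Function.update U (x, μ)
    ⟨coolMat (stapleSum (fundamentalRep (Fin 2)) U x μ), coolMat_stapleSum_mem U x μ h0⟩

section Map

variable {U : GaugeConfig d L (specialUnitaryGroup (Fin 2) ℂ)} {x : Site d L} {μ : Fin d}

omit [NeZero L] in
/-- A link with vanishing staple sum is not moved. -/
theorem su2Cool_of_eq_zero (h0 : stapleSum (fundamentalRep (Fin 2)) U x μ = 0) : su2Cool U x μ = U := dif_pos h0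

omit [NeZero L] in
/-- The cooled link is `coolMat R` (staple sum `R ≠ 0`). -/
theorem su2Cool_apply_self (h0 : stapleSum (fundamentalRep (Fin 2)) U x μ ≠ 0) :
    ((su2Cool U x μ (x, μ) : specialUnitaryGroup (Fin 2) ℂ) : Matrix (Fin 2) (Fin 2) ℂ) =
      coolMat (stapleSum (fundamentalRep (Fin 2)) U x μ) := by
  rw [su2Cool, dif_neg h0, Function.update_self]

omit [NeZero L] in
/-- The other links are not moved. -/
theorem su2Cool_apply_of_ne (U : GaugeConfig d L (specialUnitaryGroup (Fin 2) ℂ)) (x : Site d L) (μ : Fin d)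
    {e : Edge d L} (he : e ≠ (x, μ)) : su2Cool U x μ e = U e := by
  unfold su2Cool
  split_ifs
  · rfl
  · rw [Function.update_of_ne he]

omit [NeZero L] in
/-- The cooling map is a move along the fibre of its link. -/
theorem su2Cool_eq_mulSingle (U : GaugeConfig d L (specialUnitaryGroup (Fin 2) ℂ)) (x : Site d L) (μ : Fin d) :
    su2Cool U x μ = Pi.mulSingle (x, μ) (su2Cool U x μ (x, μ) * (U (x, μ))⁻¹) * U :=
  eq_mulSingle_mul_of_eq_off fun _ he => su2Cool_apply_of_ne U x μ he

omit [NeZero L] in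
/-- A link that already IS `coolMat R_e` is not moved. -/
theorem su2Cool_eq_self_of_coe_eq (h0 : stapleSum (fundamentalRep (Fin 2)) U x μ ≠ 0)
    (hlink : ((U (x, μ) : specialUnitaryGroup (Fin 2) ℂ) : Matrix (Fin 2) (Fin 2) ℂ) =
      coolMat (stapleSum (fundamentalRep (Fin 2)) U x μ)) :
    su2Cool U x μ = U := by
  funext e
  by_cases he : e = (x, μ)
  · subst he
    exact Subtype.ext (by rw [su2Cool_apply_self h0, ← hlink])
  · exact su2Cool_apply_of_ne U x μ he

/-- Cooling a link does not change its own staple sum (`L ≥ 2`). -/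
theorem stapleSum_su2Cool (hL : 2 ≤ L) (U : GaugeConfig d L (specialUnitaryGroup (Fin 2) ℂ)) (x : Site d L)
    (μ : Fin d) :
    stapleSum (fundamentalRep (Fin 2)) (su2Cool U x μ) x μ = stapleSum (fundamentalRep (Fin 2)) U x μ := by
  rw [su2Cool_eq_mulSingle, stapleSum_mulSingle_self (fundamentalRep (Fin 2)) hL]

/-- **The link action after cooling**: `S_e(cool_e U) = 4(d−1) − 2 √det R_e(U)`, the fibre minimum (`L ≥ 2`). -/
theorem linkAction_su2Cool (hL : 2 ≤ L) (U : GaugeConfig d L (specialUnitaryGroup (Fin 2) ℂ)) (x : Site d L)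
    (μ : Fin d) :
    linkAction (fundamentalRep (Fin 2)) (x, μ) (su2Cool U x μ) =
      4 * ((d - 1 : ℕ) : ℝ) - 2 * √(normSq (stapleSum (fundamentalRep (Fin 2)) U x μ)) := by
  by_cases h0 : stapleSum (fundamentalRep (Fin 2)) U x μ = 0
  · rw [su2Cool_of_eq_zero h0, su2_linkAction_eq hL, h0, Matrix.mul_zero, Matrix.trace_zero, Complex.zero_re]
    simp [normSq]
  · rw [su2_linkAction_eq hL, stapleSum_su2Cool hL, su2Cool_apply_self h0,
      re_trace_coolMat_mul (isQuat_stapleSum U x μ) h0]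

/-- **The `SU(2)` cooling map is a cooling step**: it minimises the link action over the fibre EXACTLY (`L ≥ 2`). -/
theorem isCoolingStep_su2Cool (hL : 2 ≤ L) (U : GaugeConfig d L (specialUnitaryGroup (Fin 2) ℂ)) (x : Site d L)
    (μ : Fin d) : IsCoolingStep (fundamentalRep (Fin 2)) (x, μ) U (su2Cool U x μ) := by
  unfold IsCoolingStep
  refine ⟨fun e he => su2Cool_apply_of_ne U x μ he, fun h => ?_⟩
  rw [linkAction_su2Cool hL]
  exact su2_linkAction_fibre_ge hL U x μ h

/-- **One `SU(2)` cooling update never increases the Wilson action** … -/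
theorem wilsonAction_su2Cool_le (hL : 2 ≤ L) (U : GaugeConfig d L (specialUnitaryGroup (Fin 2) ℂ)) (x : Site d L)
    (μ : Fin d) : wilsonAction (fundamentalRep (Fin 2)) (su2Cool U x μ) ≤ wilsonAction (fundamentalRep (Fin 2)) U :=
  (isCoolingStep_su2Cool hL U x μ).wilsonAction_le

/-- … and lowers it by exactly `2√det R_e − Re tr (U_e R_e) ≥ 0`. -/
theorem wilsonAction_sub_wilsonAction_su2Cool (hL : 2 ≤ L) (U : GaugeConfig d L (specialUnitaryGroup (Fin 2) ℂ))
    (x : Site d L) (μ : Fin d) :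
    wilsonAction (fundamentalRep (Fin 2)) U - wilsonAction (fundamentalRep (Fin 2)) (su2Cool U x μ) =
      2 * √(normSq (stapleSum (fundamentalRep (Fin 2)) U x μ)) -
        ((U (x, μ) : Matrix (Fin 2) (Fin 2) ℂ) * stapleSum (fundamentalRep (Fin 2)) U x μ).trace.re := by
  rw [(isCoolingStep_su2Cool hL U x μ).wilsonAction_sub_eq, linkAction_su2Cool hL, su2_linkAction_eq hL]
  ring

/-- **Strict decrease**: a cooling update that actually moves the link lowers the Wilson action STRICTLY — `S_W` is a
strict Lyapunov function of `SU(2)` cooling (`L ≥ 2`). -/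
theorem wilsonAction_su2Cool_lt (hL : 2 ≤ L) (h : su2Cool U x μ ≠ U) :
    wilsonAction (fundamentalRep (Fin 2)) (su2Cool U x μ) < wilsonAction (fundamentalRep (Fin 2)) U := by
  have h0 : stapleSum (fundamentalRep (Fin 2)) U x μ ≠ 0 := fun h0 => h (su2Cool_of_eq_zero h0)
  have hq := isQuat_stapleSum U x μ
  have hsub := wilsonAction_sub_wilsonAction_su2Cool hL U x μ
  have hle := re_trace_mul_le (SetLike.coe_mem (U (x, μ))) hq
  rcases hle.lt_or_eq with hlt | heq
  · linarith
  · exact absurd (su2Cool_eq_self_of_coe_eq h0 (eq_coolMat_of_re_trace_eq (SetLike.coe_mem (U (x, μ))) hq h0 heq)) h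

omit [NeZero L] in
/-- The cooled configuration written as the fibre move through `coolMat R · U_e⁻¹` (staple sum `R ≠ 0`). -/
theorem su2Cool_eq_mulSingle_coolMat (h0 : stapleSum (fundamentalRep (Fin 2)) U x μ ≠ 0) :
    su2Cool U x μ = Pi.mulSingle (x, μ)
      ((⟨coolMat (stapleSum (fundamentalRep (Fin 2)) U x μ), coolMat_stapleSum_mem U x μ h0⟩ :
          specialUnitaryGroup (Fin 2) ℂ) * (U (x, μ))⁻¹) * U := by
  have h := su2Cool_eq_mulSingle U x μ
  have hlink : su2Cool U x μ (x, μ) =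
      ⟨coolMat (stapleSum (fundamentalRep (Fin 2)) U x μ), coolMat_stapleSum_mem U x μ h0⟩ :=
    Subtype.ext (su2Cool_apply_self h0)
  rw [hlink] at h
  exact h

/-- **Uniqueness**: at a link with non-zero staple sum, EVERY exact cooling step (any implementation, any
tie-breaking) produces the configuration `su2Cool U x μ` (`L ≥ 2`).  Two exact `SU(2)` cooling codes run in the
same link order therefore agree link by link (away from the measure-zero event `R_e = 0`). -/
theorem IsCoolingStep.eq_su2Cool (hL : 2 ≤ L) {U' : GaugeConfig d L (specialUnitaryGroup (Fin 2) ℂ)}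
    (hc : IsCoolingStep (fundamentalRep (Fin 2)) (x, μ) U U') (h0 : stapleSum (fundamentalRep (Fin 2)) U x μ ≠ 0) :
    U' = su2Cool U x μ := by
  have hq := isQuat_stapleSum U x μ
  -- the link action of `U'` in staple form, with the staple sum of `U`
  have hS' : linkAction (fundamentalRep (Fin 2)) (x, μ) U' = 4 * ((d - 1 : ℕ) : ℝ) -
      ((U' (x, μ) : Matrix (Fin 2) (Fin 2) ℂ) * stapleSum (fundamentalRep (Fin 2)) U x μ).trace.re := by
    have h := su2_linkAction_eq hL (Pi.mulSingle (x, μ) (U' (x, μ) * (U (x, μ))⁻¹) * U) x μ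
    rw [stapleSum_mulSingle_self (fundamentalRep (Fin 2)) hL, mulSingle_mul_apply_self, inv_mul_cancel_right,
      ← hc.eq_mulSingle] at h
    exact h
  -- minimality against the cooled link and the fibre bound squeeze `Re tr (U'_e R) = 2 √det R`
  have hmin := hc.le_fibre
    (⟨coolMat (stapleSum (fundamentalRep (Fin 2)) U x μ), coolMat_stapleSum_mem U x μ h0⟩ * (U (x, μ))⁻¹)
  rw [← su2Cool_eq_mulSingle_coolMat h0, linkAction_su2Cool hL, hS'] at hmin
  have hle := re_trace_mul_le (SetLike.coe_mem (U' (x, μ))) hq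
  have heq : ((U' (x, μ) : Matrix (Fin 2) (Fin 2) ℂ) * stapleSum (fundamentalRep (Fin 2)) U x μ).trace.re =
      2 * √(normSq (stapleSum (fundamentalRep (Fin 2)) U x μ)) := le_antisymm hle (by linarith)
  have hlink : ((U' (x, μ) : specialUnitaryGroup (Fin 2) ℂ) : Matrix (Fin 2) (Fin 2) ℂ) =
      coolMat (stapleSum (fundamentalRep (Fin 2)) U x μ) :=
    eq_coolMat_of_re_trace_eq (SetLike.coe_mem (U' (x, μ))) hq h0 heq
  funext e
  by_cases he : e = (x, μ)
  · subst he
    exact Subtype.ext (by rw [hlink, su2Cool_apply_self h0])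
  · rw [hc.eq_off he, su2Cool_apply_of_ne U x μ he]

end Map

end Summit.Ventures.LatticeQCDFlow.Scoring
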